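import Summits.QuantumFields.YangMills.Theorems.BalabanUVNodesN07ChartLogAnalytic
import Summits.QuantumFields.YangMills.Theorems.UnitScaleTiltProp8ChartHInvComb
import Literature.MathematicalPhysics.QuantumFieldTheory.Balaban1983to89.B13Contraction113
import Literature.MathematicalPhysics.QuantumFieldTheory.Balaban1983to89.B8SectDSource
import Literature.MathematicalPhysics.QuantumFieldTheory.Balaban1983to89.B11Eq115Space
import HarnessLib

/-!
# BalabanUVNodes ∕ N07 — REALITY OF THE CHART (47): the solution `D(A′)` of (49) for the TRUE multi-level (0.4)-constraint takes values in every closed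
# invariant value module `S ⊆ M_n(ℂ)` (𝔤-valued `A′` ⇒ 𝔤-valued `D(A′)` and `A = A′ − HD(A′)`), generic carrier `P : Params`

Cell `pub-ymgap`, width seat `pub-ymgap-dag-n07-w2` generation 3 (HUMAN RULING D-0149; DAG node N07 = [15] = [Balaban1985Variational]; W-SEAT START LIST §n07 item 2 = S2
«[15] Sect. C (47)–(49), Prop. 3 at objects»).  `--kind proof --supports stmt-QuantumFields-20542 --as helper` (K1⁷; count-neutral).  The shape is the route `UnitScaleTilt`'s
pillar F4 part 3 (`FlatSmallSolution158Real.smallSolution158_valued`: reality of Prop. 6's small solution `A₁` via a closed invariant value set) carried to Prop. 3's `D(A′)`;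
CONSUMED BY NAME, nothing modified: lit-balaban `B8SectDSource.fixedPoint_mem_of_invariant` (Banach iteration inside a closed invariant set + uniqueness in the ball),
`B13Contraction113.{QuadAnalytic, mapsTo_T, lipschitz_T}` ((51)–(54): the self-map and contraction estimates of p. 286), `B11Eq115Space.NegSup` (the weighted carriers), this
seat's `N07ChartRemainderP.chartRemainder_hCd_hCq` ((44)) and `N07ChartLogAnalytic.analyticOnNhd_chartLog_weightedBall` (analyticity), the route `UnitScaleTilt`'s
`Prop8Chart.chartLog ∕ collar_of_adm22`.

THE PRINT ([15]): p. 285 «Let us define U₁ = e^{iηA} … A with values in the Lie algebra 𝔤» ∕ p. 289 (proof of Prop. 3) «for A′ … with values in the complexified Lie algebra 𝔤ᶜ»: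
the analyticity arguments run over `𝔤ᶜ`-valued fields while the variational problem ((5)–(6), (19)–(21), (157)–(159)) is over `𝔤`-valued ones — the solution of the real
problem is the real fixed point, because the successive approximations of p. 286 («the simple iteration method») stay `𝔤`-valued for `𝔤`-valued data when `H` and `C` preserve
`𝔤`-valued fields.  This file is that remark for the chart `D(·)` of (47)–(49), at the level of an arbitrary ℝ-submodule `S` of the fibre.

WHAT IS PROVED (sorry-free; no definition; axioms standard; generic `P`, fibre `M_ι(ℂ)`).
* ★★★ `chartD_valued` — for a torus `P`, height `k`, a (2.2)-admissible nested family `D` (`Adm22 D R′ M`, `2L ≤ R′`, `1 ≤ M`, `D.k = k`), level weights `w`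
  (`K0FlatCubeOpsTextP.IsLevWeight`), a ℂ-linear `H` with the weighted (46) letter `B₀` (DISPLAYED; no right-inverse property needed), `ε > 0` with `18C₂B₀ε ≤ 1`, `64ε ≤ R⋆`;
  an ℝ-submodule `S ⊆ M_ι(ℂ)` such that (hSH) `H` maps `S`-valued data to `S`-valued fields and (hSC) `C := chartLog η D − D(chartLog η D)(0)` maps `S`-valued fields of
  weighted size `< 2ε` to `S`-valued data (the radius the iteration actually visits; for `S` = Hermitian TRACELESS at large `N` this is where `ε ≲ 1∕N` enters); and ANY map `Dfun` obeying (55) and (49) on the weighted `ε`-ball (the conjuncts exported by `N07ChartDDerivative.exists_chartD_hasFDerivAt`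
  ∕ `N07Prop3AtRecord.exists_prop3_T4`, or the `∃!`-selector of `N07ChartDOfRecord.exists_chartD_of_rightInverse`): every `S`-valued `A′` in the ball has `Dfun A′` `S`-valued and
  `A′ − H·Dfun A′` `S`-valued.
* ★ `chartPreimage_valued` — the (59)–(62) side: for `S`-valued `A` of weighted size `< r` ((hSC) at radius `r`), the preimage point `A′ := A + H·C(A)` is `S`-valued.

HONEST FRAMING: (hSH) and (hSC) are DISPLAYED.  At `S` = the Hermitian traceless matrices (print's `𝔤` in the convention `U₁ = e^{iηA}` of (152)) they are, respectively, a
property of the right inverse of record (dag k0-s1-w1's `exists_rightInverse_chartLog_of_flatH` packages UST `ChartHInv.exists_rightInverse`, an `ℝ`-combination construction —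
the conjunct is asked for on the bus, not proved here) and a `chartLog`-reality lemma (unitary block averages, `mlog_mem_lieSU`; not here) — so the record edition of reality is NOT
claimed by this file; nothing of [15] Sects. D–F asserted; stub 1 ∕ K0⁷ ∕ K1⁷ NOT closed; N07 NOT discharged; counts unmoved (5∕27); one finite T⁴ programme at fixed ε — NOT
continuum ∕ ℝ⁴ ∕ OS ∕ mass gap ∕ Clay: the Yang–Mills mass gap is NOT proved by any of this; R4 closes the conditional rung `BalabanLadder.UV` only.  No `sorry`, no `def`, no
`instance`, no `notation`.

References: [15] T. Bałaban, CMP 102 (1985) 277–309 [Balaban1985Variational] ((43)–(55) pp.285–286, Prop. 3 p.289, (152)–(157) pp.301–302); T. Bałaban, CMP 99 (1985) 75–102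
[Balaban1985RegularSpaces] (p.93, reality of the fixed point of (1.100)); T. Bałaban, CMP 119 (1988) 243–285 [Balaban1988RG2Cluster] (p.5 after (1.13)).
-/

noncomputable section

open scoped BigOperators Matrix.Norms.L2Operator
open NormedSpace Metric Set

namespace Summit.QuantumFields.YangMills.BalabanUVNodes.N07ChartDValued

open Literature.MathematicalPhysics.QuantumFieldTheory.Balaban1983to89
open Literature.MathematicalPhysics.QuantumFieldTheory.Balaban1983to89.B6SectADomainsV1 (Domains)
open Literature.MathematicalPhysics.QuantumFieldTheory.Balaban1983to89.B6SectAOperatorsV1 (BondIdx)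
open Literature.MathematicalPhysics.QuantumFieldTheory.Balaban1983to89.B11Eq115Space (NegSup)
open Literature.MathematicalPhysics.QuantumFieldTheory.Balaban1983to89.B13Contraction113 (QuadAnalytic mapsTo_T lipschitz_T)
open Literature.MathematicalPhysics.QuantumFieldTheory.Balaban1983to89.B8SectDSource (fixedPoint_mem_of_invariant)
open Summit.QuantumFields.YangMills.Theorems.FlatCubeOpsText (Adm22)
open Summit.QuantumFields.YangMills.Theorems.K0FlatCubeOpsTextP (IsLevWeight)
open Summit.QuantumFields.YangMills.Theorems.Prop8Chart (chartLog collar_of_adm22 fderiv_chartLog_zero_apply)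
open Summit.QuantumFields.YangMills.Theorems.ChartHInv (exists_linFamily)
open BlockAveragingEMLLinearised (linAvg walkSum linAvg_def walkSum_nil walkSum_cons)
open T4Continuum (LStep)
open BlockAveraging (Idx)
open Summit.QuantumFields.YangMills.BalabanUVNodes.N07ChartRemainderP (chartRemainder_hCd_hCq)
open Summit.QuantumFields.YangMills.BalabanUVNodes.N07ChartLogAnalytic (analyticOnNhd_chartLog_weightedBall)

variable {P : Params} {ι : Type*} [Fintype ι] [DecidableEq ι] [Nonempty ι]

/-! ## §0 The linear part preserves every value module: `walkSum`, `linAvg`, `Q^{(j)}`, `D(chartLog η D)(0) = η·Q^{(j)}` -/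

omit [Fintype ι] [DecidableEq ι] [Nonempty ι] in
/-- A signed sum of `S`-valued bond variables along a walk is `S`-valued. [cite: Balaban1984PropagatorsI, (1.8) p.19] -/
theorem walkSum_mem {j : ℕ} (S : Submodule ℝ (Matrix ι ι ℂ)) {Y : PBond P j → Matrix ι ι ℂ} (hY : ∀ b, Y b ∈ S) (γ : List (LStep P j)) :
    walkSum Y γ ∈ S := by
  induction γ with
  | nil => rw [walkSum_nil]; exact S.zero_mem
  | cons s γ ih =>
    rw [walkSum_cons]
    refine S.add_mem ?_ ih
    split_ifs
    · exact hY _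
    · exact S.neg_mem (hY _)

omit [Fintype ι] [DecidableEq ι] [Nonempty ι] in
/-- The straight (linearised (0.4)) average `Q = linAvg` of an `S`-valued field is `S`-valued: it is a REAL (`|I|⁻¹`) combination of signed walk sums.
[cite: Balaban1985Averaging, (124)-(125) p.36; Balaban1987RG1, (0.4) p.253] -/
theorem linAvg_mem {j : ℕ} (S : Submodule ℝ (Matrix ι ι ℂ)) {Y : PBond P j → Matrix ι ι ℂ} (hY : ∀ b, Y b ∈ S) (c : PBond P (j + 1)) :
    linAvg Y c ∈ S := by
  rw [linAvg_def]
  have hcast : ((Fintype.card (Idx P) : ℂ))⁻¹ = (((Fintype.card (Idx P) : ℝ)⁻¹ : ℝ) : ℂ) := by push_cast; rfl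
  rw [hcast, Complex.coe_smul]
  refine S.smul_mem _ (Submodule.sum_mem S fun i _ => ?_)
  exact S.sub_mem (S.add_mem (walkSum_mem S hY _) (walkSum_mem S hY _)) (walkSum_mem S hY _)

omit [Fintype ι] [DecidableEq ι] [Nonempty ι] in
/-- Every `Q^{(j)}`-family (`Q^{(0)} = id`, `Q^{(j+1)} = linAvg ∘ Q^{(j)}`) maps `S`-valued fields to `S`-valued fields. [cite: Balaban1985Averaging, (124)-(125) p.36] -/
theorem linFamily_mem (S : Submodule ℝ (Matrix ι ι ℂ)) (Q : (i : ℕ) → (PBond P 0 → Matrix ι ι ℂ) → PBond P i → Matrix ι ι ℂ)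
    (hQ0 : ∀ Y, Q 0 Y = Y) (hQs : ∀ (i : ℕ) (Y : PBond P 0 → Matrix ι ι ℂ) (c : PBond P (i + 1)), Q (i + 1) Y c = linAvg (Q i Y) c) :
    ∀ (j : ℕ) (Y : PBond P 0 → Matrix ι ι ℂ), (∀ b, Y b ∈ S) → ∀ c, Q j Y c ∈ S := by
  intro j
  induction j with
  | zero => intro Y hY c; rw [hQ0]; exact hY c
  | succ i ih => intro Y hY c; rw [hQs]; exact linAvg_mem S (ih Y hY) c

omit [Nonempty ι] in
/-- **THE LINEARISED CONSTRAINT PRESERVES EVERY VALUE MODULE**: `D(chartLog η D)(0) Y (j, c) = η·(Q^{(j)}Y)(c)` (`Prop8Chart.fderiv_chartLog_zero_apply`) is `S`-valued for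
`S`-valued `Y` — the linear part of (hSC) holds for every ℝ-submodule `S`, so (hSC) reduces to the reality of `chartLog` itself (`chartD_valued_of_chartLog`).
[cite: Balaban1985Variational, (45) p.285, (156)-(157) p.302] -/
theorem fderiv_chartLog_zero_mem (η : ℝ) (D : Domains P) (S : Submodule ℝ (Matrix ι ι ℂ)) {Y : PBond P 0 → Matrix ι ι ℂ} (hY : ∀ b, Y b ∈ S)
    (idx : BondIdx D) :
    (fderiv ℂ (chartLog η D : (PBond P 0 → Matrix ι ι ℂ) → BondIdx D → Matrix ι ι ℂ) 0) Y idx ∈ S := by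
  obtain ⟨Q, hQ0, hQs⟩ := exists_linFamily (P := P) (n := ι)
  rw [fderiv_chartLog_zero_apply η D Q hQ0 hQs Y idx, Complex.coe_smul]
  exact S.smul_mem _ (linFamily_mem S Q hQ0 hQs _ Y hY _)

/-! ## §1 Reality of the chart -/

/-- ★★★ **REALITY OF THE CHART (47): `D(A′)` AND `A = A′ − HD(A′)` TAKE VALUES IN EVERY CLOSED INVARIANT VALUE MODULE.**  For a torus `P`, height `k`, a (2.2)-admissible
nested family `D` (`Adm22 D R′ M`, `2L ≤ R′`, `1 ≤ M`, `D.k = k`), level weights `w`, a ℂ-linear `H` with the weighted (46) letter `B₀ ≥ 0`, `ε > 0` with `18C₂B₀ε ≤ 1`,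
`64ε ≤ R⋆` (`R⋆ = 1∕(12800ℓ²L)`, `C₂ = 960ℓL∕R⋆`, `ℓ = (d+2)L`), an ℝ-submodule `S` of `M_ι(ℂ)` preserved by `H` (hSH) and by `C = chartLog η D − D(chartLog η D)(0)` on the
weighted `2ε`-ball (hSC) — the only arguments the iteration feeds to `C`, and ANY `Dfun` with (55) `‖Dfun A′ i‖ ≤ 4C₂ρ²` and (49) `C(A′ − H·Dfun A′) = Dfun A′` on the weighted `ε`-ball: if `A′` in the ball is `S`-valued, so are
`Dfun A′` and `A′ − H·Dfun A′`.  Mechanism (p. 286 «the simple iteration method» + p. 93 of [Balaban1985RegularSpaces]): on the weighted carriers the map `X ↦ C(A′ − HX)` is a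
self-map and a `9C₂B₀ε`-contraction of the closed ball `‖X‖ ≤ 4C₂ε²` (`B13Contraction113.mapsTo_T ∕ lipschitz_T`), it preserves the closed set of `S`-valued `X`, and `Dfun A′` is
its fixed point in that ball — `B8SectDSource.fixedPoint_mem_of_invariant`.
[cite: Balaban1985Variational, (49)-(55) pp.285-286, Prop. 3 p.289, (152) p.301; Balaban1985RegularSpaces, p.93; Balaban1988RG2Cluster, p.5] -/
theorem chartD_valued (k : ℕ) {R' M : ℕ} (hR'L : 2 * P.L ≤ R') (hM : 1 ≤ M) (D : Domains P) (hDk : D.k = k) (hAdm : Adm22 D R' M)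
    {w : ℕ → PBond P 0 → ℝ} (hw : IsLevWeight P k D w)
    (H : (BondIdx D → Matrix ι ι ℂ) →ₗ[ℂ] (PBond P 0 → Matrix ι ι ℂ)) {B₀ : ℝ} (hB₀ : 0 ≤ B₀)
    (hHB : ∀ (X : BondIdx D → Matrix ι ι ℂ) (t : ℝ), 0 ≤ t → (∀ i, ‖X i‖ ≤ t) → ∀ b, w 1 b * ‖H X b‖ ≤ B₀ * t)
    {ε : ℝ} (hε : 0 < ε)
    (h18 : 18 * (960 * (((P.d + 2) * P.L : ℕ) : ℝ) * (P.L : ℝ) / (12800 * (((P.d + 2) * P.L : ℕ) : ℝ) ^ 2 * (P.L : ℝ))⁻¹) * B₀ * ε ≤ 1)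
    (h2 : 64 * ε ≤ (12800 * (((P.d + 2) * P.L : ℕ) : ℝ) ^ 2 * (P.L : ℝ))⁻¹)
    (S : Submodule ℝ (Matrix ι ι ℂ))
    (hSH : ∀ X : BondIdx D → Matrix ι ι ℂ, (∀ i, X i ∈ S) → ∀ b, H X b ∈ S)
    (hSC : ∀ Y : PBond P 0 → Matrix ι ι ℂ, (∀ b, w 1 b * ‖Y b‖ < 2 * ε) → (∀ b, Y b ∈ S) →
      ∀ i, (chartLog (((P.L : ℝ)⁻¹) ^ k) D Y -
        (fderiv ℂ (chartLog (((P.L : ℝ)⁻¹) ^ k) D : (PBond P 0 → Matrix ι ι ℂ) → BondIdx D → Matrix ι ι ℂ) 0) Y) i ∈ S)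
    (Dfun : (PBond P 0 → Matrix ι ι ℂ) → (BondIdx D → Matrix ι ι ℂ))
    (h55 : ∀ A' : PBond P 0 → Matrix ι ι ℂ, (∀ b, w 1 b * ‖A' b‖ < ε) →
      ∀ (ρ : ℝ), 0 ≤ ρ → (∀ b, w 1 b * ‖A' b‖ ≤ ρ) →
        ∀ i, ‖Dfun A' i‖ ≤ 4 * (960 * (((P.d + 2) * P.L : ℕ) : ℝ) * (P.L : ℝ) / (12800 * (((P.d + 2) * P.L : ℕ) : ℝ) ^ 2 * (P.L : ℝ))⁻¹) * ρ ^ 2)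
    (h49 : ∀ A' : PBond P 0 → Matrix ι ι ℂ, (∀ b, w 1 b * ‖A' b‖ < ε) →
      chartLog (((P.L : ℝ)⁻¹) ^ k) D (A' - H (Dfun A')) -
        (fderiv ℂ (chartLog (((P.L : ℝ)⁻¹) ^ k) D : (PBond P 0 → Matrix ι ι ℂ) → BondIdx D → Matrix ι ι ℂ) 0) (A' - H (Dfun A')) = Dfun A')
    (A' : PBond P 0 → Matrix ι ι ℂ) (hA' : ∀ b, w 1 b * ‖A' b‖ < ε) (hA'S : ∀ b, A' b ∈ S) :
    (∀ i, Dfun A' i ∈ S) ∧ ∀ b, (A' - H (Dfun A')) b ∈ S := by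
  -- names for the letters
  set η : ℝ := ((P.L : ℝ)⁻¹) ^ k with hη
  set Rs : ℝ := (12800 * (((P.d + 2) * P.L : ℕ) : ℝ) ^ 2 * (P.L : ℝ))⁻¹ with hRs_def
  set C₂ : ℝ := 960 * (((P.d + 2) * P.L : ℕ) : ℝ) * (P.L : ℝ) / Rs with hC₂_def
  set Qlin := (fderiv ℂ (chartLog η D : (PBond P 0 → Matrix ι ι ℂ) → BondIdx D → Matrix ι ι ℂ) 0) with hQlin
  -- positivity of the letters
  have hL0 : (0 : ℝ) < P.L := by exact_mod_cast P.L_pos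
  have hℓ1 : (1 : ℝ) ≤ (((P.d + 2) * P.L : ℕ) : ℝ) := by
    exact_mod_cast Nat.one_le_iff_ne_zero.mpr (Nat.mul_ne_zero (by omega) (by have := P.hL.2; omega))
  have hden : 0 < 12800 * (((P.d + 2) * P.L : ℕ) : ℝ) ^ 2 * (P.L : ℝ) := by positivity
  have hRs0 : 0 < Rs := inv_pos.mpr hden
  have hRs1 : 12800 * (((P.d + 2) * P.L : ℕ) : ℝ) ^ 2 * (P.L : ℝ) * Rs ≤ 1 := by
    rw [hRs_def, mul_inv_cancel₀ hden.ne']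
  have hC₂ : 0 ≤ C₂ := by rw [hC₂_def]; positivity
  have hwpos : ∀ b, 0 < w 1 b := fun b => by rw [hw 1 b, pow_one]; positivity
  have hRM : 2 * P.L ≤ R' * M + 1 := by have : R' ≤ R' * M := Nat.le_mul_of_pos_right R' hM; omega
  have hcollar := collar_of_adm22 D hAdm hRM
  -- (44) and analyticity of the chart
  obtain ⟨-, hCq⟩ := chartRemainder_hCd_hCq (𝔸 := Matrix ι ι ℂ) k hR'L hM D hDk hAdm hw
  have han := analyticOnNhd_chartLog_weightedBall (𝔸 := Matrix ι ι ℂ) k D hDk hcollar hw hRs1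
  -- the weighted carriers
  haveI hFw : Fact (∀ b : PBond P 0, 0 < w 1 b) := ⟨hwpos⟩
  haveI hF1 : Fact (∀ _ : BondIdx D, 0 < (1 : ℝ)) := ⟨fun _ => one_pos⟩
  let eY := NegSup.continuousLinearEquiv ℂ (V := Matrix ι ι ℂ) (w 1)
  let eX := NegSup.continuousLinearEquiv ℂ (V := Matrix ι ι ℂ) (fun _ : BondIdx D => (1 : ℝ))
  have hYpt : ∀ (Y : NegSup (w 1) (Matrix ι ι ℂ)) b, w 1 b * ‖eY Y b‖ ≤ ‖Y‖ := fun Y b => NegSup.weight_mul_norm_apply_le Y b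
  have hXpt : ∀ (X : NegSup (fun _ : BondIdx D => (1 : ℝ)) (Matrix ι ι ℂ)) i, ‖eX X i‖ ≤ ‖X‖ := fun X i => by
    have h := NegSup.weight_mul_norm_apply_le (w := fun _ : BondIdx D => (1 : ℝ)) X i
    rw [one_mul] at h
    exact h
  -- the nonlinear part `C` and the transported data
  set C : (PBond P 0 → Matrix ι ι ℂ) → (BondIdx D → Matrix ι ι ℂ) := fun Y => chartLog η D Y - Qlin Y with hC
  let Ct : NegSup (w 1) (Matrix ι ι ℂ) → NegSup (fun _ : BondIdx D => (1 : ℝ)) (Matrix ι ι ℂ) := fun Y => eX.symm (C (eY Y))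
  let hop : NegSup (fun _ : BondIdx D => (1 : ℝ)) (Matrix ι ι ℂ) →ₗ[ℂ] NegSup (w 1) (Matrix ι ι ℂ) :=
    { toFun := fun X => eY.symm (H (eX X))
      map_add' := fun X X' => by simp only [map_add]
      map_smul' := fun z X => by simp only [map_smul, RingHom.id_apply] }
  have hhop_apply : ∀ X, hop X = eY.symm (H (eX X)) := fun _ => rfl
  -- (46): the transported `H` is bounded by `B₀`
  have hnormH : ∀ X, ‖hop X‖ ≤ B₀ * ‖X‖ := fun X => by
    rw [hhop_apply]
    refine (NegSup.norm_le_iff (mul_nonneg hB₀ (norm_nonneg _))).2 fun b => ?_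
    have h := hHB (eX X) ‖X‖ (norm_nonneg _) (hXpt X) b
    have hid : NegSup.equiv (w 1) (Matrix ι ι ℂ) (eY.symm (H (eX X))) b = H (eX X) b := by
      show eY (eY.symm (H (eX X))) b = H (eX X) b
      rw [ContinuousLinearEquiv.apply_symm_apply]
    rw [hid]; exact h
  -- the domain `‖Y‖ < R⋆/16` is mapped into the weighted ball of radius `R⋆`
  have hmapsY : ∀ Y : NegSup (w 1) (Matrix ι ι ℂ), ‖Y‖ < Rs / 16 → ∀ b, w 1 b * ‖eY Y b‖ < Rs := fun Y hY b =>
    (hYpt Y b).trans_lt (by linarith)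
  -- (44): the quadratic letter in the weighted norms, and analyticity along complex lines
  have hQA : QuadAnalytic Ct C₂ (Rs / 16) := by
    refine ⟨fun Y hY => ?_, fun Y₁ Y₂ => ?_⟩
    · refine (NegSup.norm_le_iff (by positivity)).2 fun i => ?_
      rw [one_mul]
      have hlt : ‖Y‖ < Rs / 4 := by linarith
      have h := hCq (eY Y) ‖Y‖ hlt (hYpt Y) i
      have hid : NegSup.equiv (fun _ : BondIdx D => (1 : ℝ)) (Matrix ι ι ℂ) (Ct Y) i = C (eY Y) i := by
        show eX (eX.symm (C (eY Y))) i = C (eY Y) i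
        rw [ContinuousLinearEquiv.apply_symm_apply]
      rw [hid]; exact h
    · intro ζ hζ
      have hline : DifferentiableAt ℂ (fun z : ℂ => eY (Y₁ + z • Y₂)) ζ :=
        eY.differentiableAt.comp ζ ((differentiableAt_const _).add (differentiableAt_id.smul_const _))
      have hpt : ∀ b, w 1 b * ‖eY (Y₁ + ζ • Y₂) b‖ < Rs := hmapsY _ hζ
      have hCd : DifferentiableAt ℂ C (eY (Y₁ + ζ • Y₂)) :=
        ((han _ hpt).differentiableAt).sub (Qlin.differentiableAt)
      exact (eX.symm.differentiableAt.comp ζ (hCd.comp ζ hline)).differentiableWithinAt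
  -- the windows of `B13Contraction113`
  have hR2 : 4 * C₂ * B₀ * ε ≤ 1 := by
    have : 0 ≤ C₂ * B₀ * ε := by positivity
    change 18 * C₂ * B₀ * ε ≤ 1 at h18
    nlinarith
  have h9 : 9 * C₂ * B₀ * ε < 1 := by
    have : 0 ≤ C₂ * B₀ * ε := by positivity
    change 18 * C₂ * B₀ * ε ≤ 1 at h18
    nlinarith
  have h64 : 64 * ε ≤ Rs := h2
  have hRC2 : 2 * ε ≤ Rs / 16 := by linarith
  have hRC3 : 3 * ε ≤ Rs / 16 := by linarith
  -- the datum on the carrier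
  have hA'n : ‖eY.symm A'‖ < ε :=
    (NegSup.norm_lt_iff hε).2 fun b => by
      have hid : NegSup.equiv (w 1) (Matrix ι ι ℂ) (eY.symm A') b = A' b := by
        show eY (eY.symm A') b = A' b
        rw [ContinuousLinearEquiv.apply_symm_apply]
      rw [hid]; exact hA' b
  -- the fixed point `x := Dfun A′` read on the carrier, in the ball `4C₂ε²`
  set x : NegSup (fun _ : BondIdx D => (1 : ℝ)) (Matrix ι ι ℂ) := eX.symm (Dfun A') with hx_def
  have heXx' : eX x = Dfun A' := by rw [hx_def, ContinuousLinearEquiv.apply_symm_apply]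
  have heXx : ∀ i, eX x i = Dfun A' i := fun i => by rw [heXx']
  have hx : ‖x‖ ≤ 4 * C₂ * ε ^ 2 := by
    refine (NegSup.norm_le_iff (by positivity)).2 fun i => ?_
    rw [one_mul]
    show ‖eX x i‖ ≤ 4 * C₂ * ε ^ 2
    rw [heXx]
    exact h55 A' hA' ε hε.le (fun b => (hA' b).le) i
  -- reading the iteration map back on plain functions
  have hread : ∀ X : NegSup (fun _ : BondIdx D => (1 : ℝ)) (Matrix ι ι ℂ), ∀ i, eX (Ct (eY.symm A' - hop X)) i = C (A' - H (eX X)) i := by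
    intro X i
    show eX (eX.symm (C (eY (eY.symm A' - eY.symm (H (eX X)))))) i = C (A' - H (eX X)) i
    rw [ContinuousLinearEquiv.apply_symm_apply, map_sub, ContinuousLinearEquiv.apply_symm_apply, ContinuousLinearEquiv.apply_symm_apply]
  have hfix : Ct (eY.symm A' - hop x) = x := by
    apply eX.injective
    funext i
    rw [hread, heXx']
    have hfun := congrFun (h49 A' hA') i
    simpa only [hC] using hfun
  -- the closed invariant set of `S`-valued data
  set T : Set (NegSup (fun _ : BondIdx D => (1 : ℝ)) (Matrix ι ι ℂ)) := {X | ∀ i, eX X i ∈ S} with hT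
  have hTclosed : IsClosed T := by
    have hrepr : T = ⋂ i, (fun X : NegSup (fun _ : BondIdx D => (1 : ℝ)) (Matrix ι ι ℂ) => eX X i) ⁻¹' (S : Set (Matrix ι ι ℂ)) := by
      ext X; simp only [hT, Set.mem_setOf_eq, Set.mem_iInter, Set.mem_preimage, SetLike.mem_coe]
    rw [hrepr]
    exact isClosed_iInter fun i => (S.closed_of_finiteDimensional).preimage ((continuous_apply i).comp eX.continuous)
  have hT0 : (0 : NegSup (fun _ : BondIdx D => (1 : ℝ)) (Matrix ι ι ℂ)) ∈ T := fun i => by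
    rw [map_zero]; exact S.zero_mem
  -- self-map, contraction, invariance on the ball
  have hmaps := mapsTo_T (A' := eY.symm A') hQA hC₂ hB₀ hnormH hA'n hR2 hRC2
  have hinv : ∀ X ∈ T, ‖X‖ ≤ 4 * C₂ * ε ^ 2 → Ct (eY.symm A' - hop X) ∈ T := by
    intro X hXT hXn i
    rw [hread]
    -- the argument `A′ − H(eX X)` is `S`-valued and of weighted size `< 2ε`
    have hHX : ∀ b, w 1 b * ‖H (eX X) b‖ ≤ B₀ * (4 * C₂ * ε ^ 2) := fun b =>
      hHB (eX X) (4 * C₂ * ε ^ 2) (by positivity) (fun j => (hXpt X j).trans hXn) b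
    have hsize : ∀ b, w 1 b * ‖(A' - H (eX X)) b‖ < 2 * ε := fun b => by
      rw [Pi.sub_apply]
      have h1 : w 1 b * ‖A' b - H (eX X) b‖ ≤ w 1 b * ‖A' b‖ + w 1 b * ‖H (eX X) b‖ := by
        rw [← mul_add]; exact mul_le_mul_of_nonneg_left (norm_sub_le _ _) (hwpos b).le
      have h2' : B₀ * (4 * C₂ * ε ^ 2) ≤ ε := by
        have : B₀ * (4 * C₂ * ε ^ 2) = (4 * C₂ * B₀ * ε) * ε := by ring
        rw [this]; nlinarith
      linarith [hA' b, hHX b]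
    exact hSC _ hsize (fun b => S.sub_mem (hA'S b) (hSH _ hXT b)) i
  have hmem : x ∈ T :=
    fixedPoint_mem_of_invariant (fun X => Ct (eY.symm A' - hop X)) (by positivity) (by positivity) h9
      (fun X hX => by
        have h := hmaps (mem_closedBall_zero_iff.2 hX)
        exact mem_closedBall_zero_iff.1 h)
      (fun X₁ X₂ h₁ h₂ => lipschitz_T (A' := eY.symm A') hQA hC₂ hB₀ hnormH hA'n hR2 hRC3
        (mem_closedBall_zero_iff.2 h₁) (mem_closedBall_zero_iff.2 h₂))
      T hTclosed hT0 hinv hx hfix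
  have hDS : ∀ i, Dfun A' i ∈ S := fun i => by rw [← heXx]; exact hmem i
  exact ⟨hDS, fun b => by rw [Pi.sub_apply]; exact S.sub_mem (hA'S b) (hSH _ hDS b)⟩

omit [Nonempty ι] in
/-- ★ **THE (59)–(62) SIDE: THE PREIMAGE POINT IS `S`-VALUED.**  For an ℝ-submodule `S` preserved by `H` (hSH) and by `C = chartLog η D − D(chartLog η D)(0)` on the weighted
`r`-ball (hSC): every `S`-valued `A` of weighted size `< r` has the (60) preimage point `A′ := A + H·C(A)` `S`-valued («To solve the equation A′ − HD(A′) = A … we take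
A′ = A + HX», X = C(A) by (61)–(62); with `chartD_valued` and the uniqueness of `N07ChartDOfRecord.chartRange_of_rightInverse`, the chart (47) restricts to a chart of the
`S`-valued fields). [cite: Balaban1985Variational, (59)-(62) p.287, Prop. 3 p.289] -/
theorem chartPreimage_valued (k : ℕ) (D : Domains P) {w : ℕ → PBond P 0 → ℝ}
    (H : (BondIdx D → Matrix ι ι ℂ) →ₗ[ℂ] (PBond P 0 → Matrix ι ι ℂ)) (S : Submodule ℝ (Matrix ι ι ℂ))
    (hSH : ∀ X : BondIdx D → Matrix ι ι ℂ, (∀ i, X i ∈ S) → ∀ b, H X b ∈ S) {r : ℝ}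
    (hSC : ∀ Y : PBond P 0 → Matrix ι ι ℂ, (∀ b, w 1 b * ‖Y b‖ < r) → (∀ b, Y b ∈ S) →
      ∀ i, (chartLog (((P.L : ℝ)⁻¹) ^ k) D Y -
        (fderiv ℂ (chartLog (((P.L : ℝ)⁻¹) ^ k) D : (PBond P 0 → Matrix ι ι ℂ) → BondIdx D → Matrix ι ι ℂ) 0) Y) i ∈ S)
    (A : PBond P 0 → Matrix ι ι ℂ) (hA : ∀ b, w 1 b * ‖A b‖ < r) (hAS : ∀ b, A b ∈ S) :
    ∀ b, (A + H (chartLog (((P.L : ℝ)⁻¹) ^ k) D A -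
      (fderiv ℂ (chartLog (((P.L : ℝ)⁻¹) ^ k) D : (PBond P 0 → Matrix ι ι ℂ) → BondIdx D → Matrix ι ι ℂ) 0) A)) b ∈ S := fun b => by
  rw [Pi.add_apply]
  exact S.add_mem (hAS b) (hSH _ (hSC A hA hAS) b)

/-- ★★★ **REALITY OF THE CHART FROM THE REALITY OF `chartLog` ALONE.**  As `chartD_valued`, with (hSC) replaced by (hSlog): `chartLog η D` maps `S`-valued fields of weighted
size `< 2ε` to `S`-valued data — the linear part `D(chartLog η D)(0) = η·Q^{(j)}` preserves every ℝ-submodule by `fderiv_chartLog_zero_mem`.  (At `S` = the Hermitian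
traceless matrices, (hSlog) is «the (0.4) averages of a unitary field are unitary, `(1∕i)log` of a special unitary near `1` is Hermitian traceless»; (hSH) is the value-module
conjunct of the right inverse of record — both displayed.) [cite: Balaban1985Variational, (49)-(55) pp.285-286, Prop. 3 p.289, (152) (156) pp.301-302; Balaban1985RegularSpaces, p.93] -/
theorem chartD_valued_of_chartLog (k : ℕ) {R' M : ℕ} (hR'L : 2 * P.L ≤ R') (hM : 1 ≤ M) (D : Domains P) (hDk : D.k = k) (hAdm : Adm22 D R' M)
    {w : ℕ → PBond P 0 → ℝ} (hw : IsLevWeight P k D w)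
    (H : (BondIdx D → Matrix ι ι ℂ) →ₗ[ℂ] (PBond P 0 → Matrix ι ι ℂ)) {B₀ : ℝ} (hB₀ : 0 ≤ B₀)
    (hHB : ∀ (X : BondIdx D → Matrix ι ι ℂ) (t : ℝ), 0 ≤ t → (∀ i, ‖X i‖ ≤ t) → ∀ b, w 1 b * ‖H X b‖ ≤ B₀ * t)
    {ε : ℝ} (hε : 0 < ε)
    (h18 : 18 * (960 * (((P.d + 2) * P.L : ℕ) : ℝ) * (P.L : ℝ) / (12800 * (((P.d + 2) * P.L : ℕ) : ℝ) ^ 2 * (P.L : ℝ))⁻¹) * B₀ * ε ≤ 1)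
    (h2 : 64 * ε ≤ (12800 * (((P.d + 2) * P.L : ℕ) : ℝ) ^ 2 * (P.L : ℝ))⁻¹)
    (S : Submodule ℝ (Matrix ι ι ℂ))
    (hSH : ∀ X : BondIdx D → Matrix ι ι ℂ, (∀ i, X i ∈ S) → ∀ b, H X b ∈ S)
    (hSlog : ∀ Y : PBond P 0 → Matrix ι ι ℂ, (∀ b, w 1 b * ‖Y b‖ < 2 * ε) → (∀ b, Y b ∈ S) → ∀ i, chartLog (((P.L : ℝ)⁻¹) ^ k) D Y i ∈ S)
    (Dfun : (PBond P 0 → Matrix ι ι ℂ) → (BondIdx D → Matrix ι ι ℂ))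
    (h55 : ∀ A' : PBond P 0 → Matrix ι ι ℂ, (∀ b, w 1 b * ‖A' b‖ < ε) →
      ∀ (ρ : ℝ), 0 ≤ ρ → (∀ b, w 1 b * ‖A' b‖ ≤ ρ) →
        ∀ i, ‖Dfun A' i‖ ≤ 4 * (960 * (((P.d + 2) * P.L : ℕ) : ℝ) * (P.L : ℝ) / (12800 * (((P.d + 2) * P.L : ℕ) : ℝ) ^ 2 * (P.L : ℝ))⁻¹) * ρ ^ 2)
    (h49 : ∀ A' : PBond P 0 → Matrix ι ι ℂ, (∀ b, w 1 b * ‖A' b‖ < ε) →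
      chartLog (((P.L : ℝ)⁻¹) ^ k) D (A' - H (Dfun A')) -
        (fderiv ℂ (chartLog (((P.L : ℝ)⁻¹) ^ k) D : (PBond P 0 → Matrix ι ι ℂ) → BondIdx D → Matrix ι ι ℂ) 0) (A' - H (Dfun A')) = Dfun A')
    (A' : PBond P 0 → Matrix ι ι ℂ) (hA' : ∀ b, w 1 b * ‖A' b‖ < ε) (hA'S : ∀ b, A' b ∈ S) :
    (∀ i, Dfun A' i ∈ S) ∧ ∀ b, (A' - H (Dfun A')) b ∈ S :=
  chartD_valued k hR'L hM D hDk hAdm hw H hB₀ hHB hε h18 h2 S hSH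
    (fun Y hY hYS i => by rw [Pi.sub_apply]; exact S.sub_mem (hSlog Y hY hYS i) (fderiv_chartLog_zero_mem _ D S hYS i))
    Dfun h55 h49 A' hA' hA'S

end Summit.QuantumFields.YangMills.BalabanUVNodes.N07ChartDValued

end
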